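import Literature.AlgebraicTopology.SingularHomology.SubsetCochains
import Literature.AlgebraicTopology.SingularHomology.RelativeCapProduct
import HarnessLib

/-!
# Capping with a cochain of an open subset: the chain-level cap product for Čech duality

H. Miller, *Lectures on Algebraic Topology* (2020), §34 ("Cap product and Čech cohomology"): the
action of `H^p(U)`, `U ⊇ K` open, on `H_*(X, X - K) = H_*(U, U - K)` (excision), whose limit
over `U` is the cap product `Ȟ^p(K) ⊗ H_n(X, X - K) → H_q(X, X - K)` of Thm. 36.1; and A. Hatcher,
*Algebraic Topology* (2002), §3.3 pp. 239–241 (the Alexander–Whitney cap product, its boundary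
formula and locality).

Chain level, inside the one concrete complex `C(X)` (`SubsetCochains.lean`: a `p`-cochain *of the
open set `U`* is an `R`-linear functional `f` on the chains `C(U)ₚ ⊆ C(X)ₚ` with image in `U`):

* `subsetCochains.extZero f` — the extension of `f` by zero to a function on all singular
  `p`-simplices of `X` (value `f(σ)` on simplices with image in `U`, `0` otherwise), so that the
  tree's Alexander–Whitney cap `ccapChain` (`RelativeCapProduct.lean`) applies: `x ⌢ f := x ⌢ extZero f`;
* **locality** `ccapChain_congr_of_mem`: on chains with image in `A` the cap only sees the values
  of the cochain on simplices in `A` (front faces of simplices in `A` lie in `A`); hence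
  `ccapChain_extZero_res`: capping a `U'`-small chain with `f|U'` or with `f` is the same;
* **the cocycle kills the correction term**: if `f` is a cocycle of `Hom(C(U), R)` then the
  coboundary of `extZero f` vanishes on simplices in `U` (`d_extZero_apply_eq_zero`), so
  `x ⌢ δ(extZero f) = 0` for `U`-small `x` and the boundary formula reads
  `∂(x ⌢ f) = (-1)ᵖ ∂x ⌢ f` (`d_ccapChain_extZero_of_mem`; Hatcher p. 240);
* consequences for relative cycles: capping a `U`-small chain whose boundary has image in `A`
  gives a chain whose boundary has image in `A` (`d_ccapChain_extZero_mem`).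

Coefficients: `R`-valued cochains act on `R`-chains (`N = R`); to avoid universe lifts the space
and the ring live in the same universe. Everything is proved; no named facts. The passage to
(co)homology classes (`Ȟ^p(K) → H_q(X | K)`) is the next file.

## References

* H. Miller, *Lectures on Algebraic Topology*, World Scientific 2020, §34, Thm. 36.1. [Miller2020]
* A. Hatcher, *Algebraic Topology*, CUP 2002, §3.3 pp. 239–241. [HatcherAT2002]
-/

noncomputable section

-- as in `SingularChainsConcrete` / `RelativeCapProduct`: chains of the concrete complex are
-- `Finsupp`s up to unfolding semireducible definitions
set_option backward.isDefEq.respectTransparency false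

open CategoryTheory Limits Opposite

universe u

namespace Literature.AlgebraicTopology.SingularHomology

namespace subsetCochains

variable {R : Type u} [CommRing R] {X : Type u} [TopologicalSpace X]
variable {M : Type u} [AddCommGroup M] [Module R M]


/-- A `p`-cochain of `U` (an element of `Hom_R(C(U)ₚ, R)`) viewed as the morphism `C(U)ₚ ⟶ R` it is.
[folklore] -/
abbrev toHom {U : Set X} {p : ℕ} (f : (subsetCochains R (ModuleCat.of R R) U).X p) :
    (chainsInSub R R X U).toComplex.X p ⟶ (ModuleCat.of R R) := f

/-! ### Extension by zero -/

/-- The elementary `U`-small chain `1 • σ` for a simplex `σ` with image in `U`. [folklore] -/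
def singleU {U : Set X} {p : ℕ} (σ : SingularSimplex X p) (h : σ.range ⊆ U) :
    (chainsInSub R R X U).toComplex.X p :=
  ⟨Finsupp.single σ 1, single_mem_chainsIn R R h 1⟩

/-- The underlying chain of `singleU σ h` is `single σ 1`. [folklore] -/
@[simp] lemma singleU_val {U : Set X} {p : ℕ} (σ : SingularSimplex X p) (h : σ.range ⊆ U) :
    (singleU (R := R) σ h).1 = Finsupp.single σ 1 := rfl

open Classical in
/-- **Extension by zero** of a cochain of the open set `U` (a functional on `C(U)ₚ`) to a function
on all singular `p`-simplices of `X`: `σ ↦ f(σ)` if `σ` has image in `U`, else `0` (Miller 2020,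
§34: cochains of `U` acting on `U`-small chains). [cite: Miller2020, §34] -/
def extZero {U : Set X} {p : ℕ} (f : (subsetCochains R (ModuleCat.of R R) U).X p) : SingularSimplex X p → R :=
  fun σ => if h : σ.range ⊆ U then toHom f (singleU σ h) else 0

/-- On a simplex with image in `U` the extension is the value of `f`. [folklore] -/
lemma extZero_apply_of_subset {U : Set X} {p : ℕ} (f : (subsetCochains R (ModuleCat.of R R) U).X p)
    {σ : SingularSimplex X p} (h : σ.range ⊆ U) : extZero f σ = toHom f (singleU σ h) := by
  classical
  exact dif_pos h

/-- Off `U` the extension is zero. [folklore] -/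
lemma extZero_apply_of_not_subset {U : Set X} {p : ℕ} (f : (subsetCochains R (ModuleCat.of R R) U).X p)
    {σ : SingularSimplex X p} (h : ¬σ.range ⊆ U) : extZero f σ = 0 := by
  classical
  exact dif_neg h

/-- Extension by zero is additive. [folklore] -/
lemma extZero_add {U : Set X} {p : ℕ} (f g : (subsetCochains R (ModuleCat.of R R) U).X p) :
    extZero (f + g) = extZero f + extZero g := by
  funext σ
  by_cases h : σ.range ⊆ U
  · rw [Pi.add_apply, extZero_apply_of_subset _ h, extZero_apply_of_subset _ h,
      extZero_apply_of_subset _ h]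
    rfl
  · rw [Pi.add_apply, extZero_apply_of_not_subset _ h, extZero_apply_of_not_subset _ h,
      extZero_apply_of_not_subset _ h, add_zero]

/-- **A cochain of `U` is determined by its extension by zero**: on a `U`-small chain `x`,
`f(x) = ∑_σ x(σ) · (extZero f)(σ)`. [folklore] -/
theorem toHom_apply_eq_linearCombination {U : Set X} {p : ℕ} (f : (subsetCochains R (ModuleCat.of R R) U).X p)
    (x : (chainsInSub R R X U).toComplex.X p) :
    toHom f x = Finsupp.linearCombination R (extZero f) x.1 := by
  set gen : Set (CChain R X p) := (fun σ => Finsupp.single σ (1 : R)) '' simplicesIn X U p with hgen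
  have hle : Submodule.span R gen = chainsIn R R X U p :=
    (Finsupp.supported_eq_span_single R (simplicesIn X U p)).symm
  have hmem : ∀ c, c ∈ Submodule.span R gen → c ∈ (chainsInSub R R X U) p := fun c hc => by
    rw [hle] at hc
    exact hc
  have hx : x.1 ∈ Submodule.span R gen := by
    rw [hle]
    exact x.2
  have key : ∀ (c : CChain R X p) (hc : c ∈ Submodule.span R gen),
      toHom f ⟨c, hmem c hc⟩ = Finsupp.linearCombination R (extZero f) c := by
    intro c hc
    induction hc using Submodule.span_induction with
    | mem c hc =>
      obtain ⟨σ, hσ, rfl⟩ := hc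
      rw [Finsupp.linearCombination_single, one_smul,
        extZero_apply_of_subset f ((mem_simplicesIn σ).mp hσ)]
      rfl
    | zero =>
      rw [map_zero]
      exact (map_zero (toHom f).hom)
    | add a b ha hb iha ihb =>
      rw [map_add, ← iha, ← ihb]
      exact map_add (toHom f).hom ⟨a, hmem a ha⟩ ⟨b, hmem b hb⟩
    | smul r a ha iha =>
      rw [map_smul, ← iha]
      exact map_smul (toHom f).hom r ⟨a, hmem a ha⟩
  exact key x.1 hx

/-- Extension by zero is homogeneous. [folklore] -/
lemma extZero_smul {U : Set X} {p : ℕ} (r : R) (f : (subsetCochains R (ModuleCat.of R R) U).X p) :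
    extZero (r • f) = r • extZero f := by
  funext σ
  by_cases h : σ.range ⊆ U
  · rw [Pi.smul_apply, extZero_apply_of_subset _ h, extZero_apply_of_subset _ h]
    rfl
  · rw [Pi.smul_apply, extZero_apply_of_not_subset _ h, extZero_apply_of_not_subset _ h, smul_zero]

/-- **The extension of a restricted cochain agrees with the original on the smaller open set**:
for `U' ⊆ U` and `σ` with image in `U'`, `extZero (f|U') σ = extZero f σ`. [folklore] -/
lemma extZero_res_apply {U U' : Set X} (hU : U' ⊆ U) {p : ℕ} (f : (subsetCochains R (ModuleCat.of R R) U).X p)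
    {σ : SingularSimplex X p} (h : σ.range ⊆ U') :
    extZero ((res R (ModuleCat.of R R) hU).f p f) σ = extZero f σ := by
  rw [extZero_apply_of_subset _ h, extZero_apply_of_subset _ (h.trans hU), res_f_apply,
    ModuleCat.comp_apply]
  rfl

/-! ### Locality of the cap product -/

variable {p q n : ℕ}

/-- **Locality**: on a chain with image in `A`, the Alexander–Whitney cap product only depends on
the values of the cochain on simplices with image in `A` (front faces of simplices in `A` lie in
`A`; Hatcher 2002, §3.3, p. 240). [cite: HatcherAT2002, §3.3 p. 240] -/
theorem ccapChain_congr_of_mem (h : p + q = n) {φ φ' : SingularSimplex X p → R} {A : Set X}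
    (hφ : ∀ σ : SingularSimplex X p, σ.range ⊆ A → φ σ = φ' σ) {c : CChain M X n}
    (hc : c ∈ chainsIn R M X A n) : ccapChain M h φ c = ccapChain M h φ' c := by
  rw [← Finsupp.sum_single c, Finsupp.sum, map_sum, map_sum]
  refine Finset.sum_congr rfl fun σ hσ => ?_
  rw [ccapChain_single, ccapChain_single,
    hφ _ ((SingularSimplex.range_frontFace_subset _ σ).trans ((mem_chainsIn_iff R M c).mp hc σ hσ))]

/-- Capping a `U'`-small chain with `f|U'` or with `f` is the same (`U' ⊆ U`). [folklore] -/
theorem ccapChain_extZero_res (h : p + q = n) {U U' : Set X} (hU : U' ⊆ U)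
    (f : (subsetCochains R (ModuleCat.of R R) U).X p) {c : CChain M X n} (hc : c ∈ chainsIn R M X U' n) :
    ccapChain M h (extZero ((res R (ModuleCat.of R R) hU).f p f)) c = ccapChain M h (extZero f) c :=
  ccapChain_congr_of_mem h (fun _ hσ => extZero_res_apply hU f hσ) hc

/-! ### Cocycles: the coboundary of the extension vanishes on `U` -/

/-- **The coboundary of the extension by zero is the extension of the coboundary, on simplices with
image in `U`**: `δ(extZero g)(τ) = ∑ (-1)ⁱ g(face i τ) = g(∂τ) = extZero (δg)(τ)` for `τ ⊆ U`
(Hatcher 2002, §3.1, `δφ = φ∂`). [folklore] -/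
theorem d_extZero_apply_of_subset {U : Set X} (g : (subsetCochains R (ModuleCat.of R R) U).X p)
    (τ : SingularSimplex X (p + 1)) (hτ : τ.range ⊆ U) :
    (singularCochainComplex R R X).d p (p + 1) (extZero g) τ =
      extZero ((subsetCochains R (ModuleCat.of R R) U).d p (p + 1) g) τ := by
  have hface : ∀ i : Fin (p + 2), (τ.face i).range ⊆ U :=
    fun i => (SingularSimplex.range_face_subset i τ).trans hτ
  have h1 : extZero ((subsetCochains R (ModuleCat.of R R) U).d p (p + 1) g) τ =
      toHom g ((chainsInSub R R X U).toComplex.d (p + 1) p (singleU τ hτ)) := by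
    rw [extZero_apply_of_subset _ hτ]
    change toHom ((subsetCochains R (ModuleCat.of R R) U).d p (p + 1) g) (singleU τ hτ) = _
    rw [dualObj_d_apply, ModuleCat.comp_apply]
  rw [h1, toHom_apply_eq_linearCombination, Subcomplex.toComplex_d_apply_val, singleU_val,
    csingularChainComplex.d_single, map_sum, singularCochainComplex.d_apply]
  simp_rw [map_smul, Finsupp.linearCombination_single, one_smul]

/-- The extension by zero of the zero cochain is zero. [folklore] -/
@[simp] lemma extZero_zero {U : Set X} : extZero (0 : (subsetCochains R (ModuleCat.of R R) U).X p) = 0 := by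
  have h := extZero_smul (0 : R) (0 : (subsetCochains R (ModuleCat.of R R) U).X p)
  rwa [zero_smul, zero_smul] at h

/-- **If `f` is a cocycle of `Hom(C(U), R)`, the coboundary of its extension by zero vanishes on
every simplex with image in `U`**: `δ(extZero f)(τ) = f(∂τ) = 0`. [folklore] -/
theorem d_extZero_apply_eq_zero {U : Set X} (f : (subsetCochains R (ModuleCat.of R R) U).X p)
    (hf : (subsetCochains R (ModuleCat.of R R) U).d p (p + 1) f = 0) (τ : SingularSimplex X (p + 1)) (hτ : τ.range ⊆ U) :
    (singularCochainComplex R R X).d p (p + 1) (extZero f) τ = 0 := by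
  rw [d_extZero_apply_of_subset f τ hτ, hf, extZero_zero, Pi.zero_apply]

/-- **The correction term vanishes**: for a cocycle `f` of `Hom(C(U), R)` and a `U`-small chain `x`,
`x ⌢ δ(extZero f) = 0`. [folklore] -/
theorem ccapChain_d_extZero_of_mem (h : (p + 1) + q = n) {U : Set X} (f : (subsetCochains R (ModuleCat.of R R) U).X p)
    (hf : (subsetCochains R (ModuleCat.of R R) U).d p (p + 1) f = 0) {x : CChain M X n} (hx : x ∈ chainsIn R M X U n) :
    ccapChain M h ((singularCochainComplex R R X).d p (p + 1) (extZero f)) x = 0 := by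
  rw [ccapChain_congr_of_mem h (φ' := 0) (fun σ hσ => d_extZero_apply_eq_zero f hf σ hσ) hx,
    ccapChain_zero]
  rfl

/-- **Boundary formula for cocycles of `U` on `U`-small chains**:
`∂(x ⌢ f) = (-1)ᵖ ∂x ⌢ f` (Hatcher 2002, §3.3, p. 240). [cite: HatcherAT2002, §3.3 p. 240] -/
theorem d_ccapChain_extZero_of_mem (h : p + q = n) {U : Set X} (f : (subsetCochains R (ModuleCat.of R R) U).X p)
    (hf : (subsetCochains R (ModuleCat.of R R) U).d p (p + 1) f = 0) {x : CChain M X (n + 1)}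
    (hx : x ∈ chainsIn R M X U (n + 1)) :
    (csingularChainComplex R M X).d (q + 1) q (ccapChain M (show p + (q + 1) = n + 1 by omega) (extZero f) x) =
      (-1 : R) ^ p • ccapChain M h (extZero f) ((csingularChainComplex R M X).d (n + 1) n x) := by
  rw [d_ccapChain_apply h, ccapChain_d_extZero_of_mem (show (p + 1) + q = n + 1 by omega) f hf hx, sub_zero]

/-- **Capping preserves relative cycles**: for a cocycle `f` of `U`, a `U`-small chain `x` whose
boundary has image in `A` caps to a chain whose boundary has image in `A`
(Hatcher 2002, §3.3, p. 240). [cite: HatcherAT2002, §3.3 p. 240] -/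
theorem d_ccapChain_extZero_mem (h : p + q = n) {U A : Set X} (f : (subsetCochains R (ModuleCat.of R R) U).X p)
    (hf : (subsetCochains R (ModuleCat.of R R) U).d p (p + 1) f = 0) {x : CChain M X n} (hxU : x ∈ chainsIn R M X U n)
    (hxA : (csingularChainComplex R M X).d n ((ComplexShape.down ℕ).next n) x ∈
      chainsIn R M X A ((ComplexShape.down ℕ).next n)) :
    (csingularChainComplex R M X).d q ((ComplexShape.down ℕ).next q) (ccapChain M h (extZero f) x) ∈
      chainsIn R M X A ((ComplexShape.down ℕ).next q) := by
  cases q with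
  | zero =>
    rw [(csingularChainComplex R M X).shape 0 _ (by simp)]
    exact Submodule.zero_mem _
  | succ q' =>
    obtain rfl : n = (p + q') + 1 := by omega
    rw [ChainComplex.next_nat_succ] at hxA ⊢
    rw [d_ccapChain_extZero_of_mem (rfl : p + q' = p + q') f hf hxU]
    exact Submodule.smul_mem _ _ (ccapChain_mem_chainsIn _ _ hxA)

end subsetCochains

end Literature.AlgebraicTopology.SingularHomology
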